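import Summits.AtomisticToContinuum.Crystallization.Theses.OneCentreSteepnessLadder
import Summits.AtomisticToContinuum.Crystallization.Theorems.HullExactificationCascadeHullPeriodicCrystallizes
import Literature.MathematicalPhysics.StatisticalMechanics.CrystallizationLocalLimit
import Literature.MathematicalPhysics.StatisticalMechanics.CrystallizationSymmetries

/-!
# Crux `ExactificationCascade` (stmt-AtomisticToContinuum-12885) — birth skeleton `Lines/birth.lean`

Route `OneCentreSteepnessLadder` (route-AtomisticToContinuum-OneCentreSteepnessLadder), crux rank 4:

  `ExactificationCascade` — HULL EXACTIFICATION on the (2q,q) ladder: for `q ≥ 4`, `δ, a, h > 0` in the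
  window `2a < 3h`, `6h < 5a`, if all `V_q = miePotential q` ground states are `δ`-separated and, for EVERY
  `η > 0`, the fraction of particles whose closed `(5a/3)`-neighbourhood is not `η`-matched (both ways, up
  to a linear isometry) to the hcp(a,h) site environment tends to `0` along every ground-state sequence,
  then `IsCrystallizing (miePotential q) 3` (Blanc–Lewin (16): local convergence of translated
  subsequences to a non-zero periodic point measure).

THE LINE (soft, no energy: centred extraction ⟹ exactification in the limit ⟹ relaxed-hcp rigidity ⟹
periodic realisation), three registered stubs, each cut at one of the compactness / rigidity seams
named in the crux docstring and in its `why it might fail`: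

* `stub_centredExtraction` (M, provable now) — DIAGONAL HULL LIMIT AROUND GOOD CENTRES: a uniformly
  `δ`-separated sequence of configurations `x N` (`N` particles) whose `η`-defective particles have
  density `→ 0` for EVERY `η > 0` admits a subsequence `σ`, recentrings `τ j` and a `δ`-separated local
  limit `X ∋ 0` (two-way `ε`-matching on every ball, eventually in `j` — the clause of
  `IsLocalLimitOfGroundStates` / `PeriodicConfiguration.tendsto_sum_of_eventually_near` verbatim) such
  that, for every `R` and `η > 0`, EVENTUALLY every recentred particle in the `R`-ball is `η`-good.
  Pure point-set statement (no potential, no ground states): counting (`δ`-separation ⇒ `≤ C(R/δ)³`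
  particles per `R`-ball, so the particles having an `η_k`-defect within `R_k` have density `→ 0`),
  diagonal level `K(N) → ∞`, `exists_subseq_forall_eventually_ballMatch` (LocalMatchingCompactness.lean),
  `0 ∈ X` from matching at every tolerance + separation of `X`.
* `stub_exactEnvironments` (M, provable now) — EXACTIFICATION IN THE LIMIT (the crux's first named risk:
  "two-way closed-ball matching must pass to exact environments under local limits"): along a locally
  convergent (two-way matched) sequence that is eventually `η`-good on balls for every `η`, every point `p`
  of the `δ`-separated limit `X` has an EXACT hcp(a,h) environment: one linear isometry `A` with
  `p + A s ∈ X` for all sites `‖s‖ ≤ 5a/3` and `X ∩ B°(p, 5a/3) ⊆ p + A(hcp)` — closed outer ball for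
  the sites, OPEN ball for the foreign-point exclusion (the boundary sphere is where a closed clause would
  not pass to the limit; the window keeps all 20 environment sites strictly inside `5a/3`, evidence
  `hcp_shells.py` on the crux: 20 inside / 0 on the sphere for `h/a ∈ (2/3, 5/6)`). Proof: finitely many
  maps from the 21 sites `{s ∈ hcp : ‖s‖ ≤ 5a/3}` (finite: `le_dist_of_mem_barlowStacking`) into the finite
  `X ∩ B̄(p, 5a/3 + 1)` ⇒ one map `F` recurs as `(ε, η) → 0` ⇒ `F` is distance-exact with `F 0 = p`;
  Gram-matrix extension of `s ↦ F s − p` to a linear isometry (as in the landed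
  `ExactHcpLocal.exact_cluster`, Theorems/HullExactificationCascadeExactHcpLocalTheoremExactify.lean);
  a foreign `y ∈ X` with `dist y p < 5a/3` is matched at late times to `z i + A_j s_j` with
  `‖s_j‖ < 5a/3` eventually, hence `y = F s_j`.  No compactness of `O(3)` needed.
* `stub_relaxedHcpRigidity` (M–L, THE GEOMETRIC HEART; the crux's second named risk) — LOCAL-TO-GLOBAL
  RIGIDITY OF RELAXED hcp FROM EXACT `5a/3`-ENVIRONMENTS, for ALL `h/a ∈ (2/3, 5/6)` incl. the ideal ratio
  `√(2/3)`: a nonempty `X ⊆ ℝ³` every point of which carries an exact hcp(a,h) environment (as delivered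
  by stub 2) is `g '' hcpStacking a h` for a Euclidean isometry `g`.  Plan (crux docstring): the 20-site
  environment = hexagon at `a` (pins the layer plane), `3+3` at `√(a²/3+h²)` and `3+3` at `√(4a²/3+h²)`
  (pin the adjacent layers over holes, spacing `h`), axial pair at `2h` (forces ABAB); propagate site by
  site as in the landed `ExactHcpLocal.all_layers` / `eq_hcpStacking_of_clusters` (which cover only the
  envelope `0.64a² < h² < 0.69a²` with the 13/10·a cluster — here the window is the full `(2/3, 5/6)` and
  the cluster radius `5a/3`); no room for foreign points: covering radius of hcp(a,h) `< 5a/3`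
  (`exists_hcp_site_near`) + the open-ball clause + homogeneity (`hcpStacking_homogeneous`).  Refuter
  evidence on the crux (`grow_rigidity.py`, `ideal_rigidity.py`): growth from the exact 5a/3 cluster rule
  is unambiguous at 5 ratios incl. the ideal one (0 ambiguous / 0 inconsistent, grown set = hcp).
* `ExactificationCascade_of_parts` — the kernel-checked implication `stub₁-sig → stub₂-sig → stub₃-sig →
  <crux statement verbatim>` (sorry-free REAL proof): separation and zero defect density of the given
  ground-state sequence from the crux hypotheses; stub 1 ⟹ `(σ, τ, X)`; stub 2 on `z j i := x (σ j) i + τ j`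
  ⟹ exact environments; stub 3 ⟹ `X = g '' hcpStacking a h`; PERIODIC REALISATION (proved here, not a
  stub): `g '' hcpStacking a h = P'.points` for the periodic configuration
  `P' = ((hcpPeriodicConfiguration a h).isometryImage A).translate (g 0)` (Mazur–Ulam, landed
  `hullPeriodic_exists_points_eq_image` + `hcpPeriodicConfiguration_points`), multiplicity `m ≡ 1`, and the
  matching is literally hypothesis `h` of `PeriodicConfiguration.tendsto_sum_of_eventually_near'`
  (CrystallizationLocalLimit.lean) with the separation `δ` of the crux.
* `ExactificationCascade_of : OneCentreSteepnessLadder.ExactificationCascade` — the skeleton theorem: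
  `_of_parts` applied to the three stubs; the ONLY theorem concluding the crux BY NAME.

Sorries live ONLY in the three `stub_*`; their signatures are fully inlined, fully qualified one-liners
over Literature declarations (`hcpStacking`, `IsGroundState`, `miePotential`, `IsCrystallizing`), so a
`Theorems/`-side `--supports stmt-AtomisticToContinuum-12885` file can restate them textually.
Disproof.lean: none exists for this crux at registration (`ledger crux ls stmt-AtomisticToContinuum-12885`,
2026-08-17: no workfiles); nothing to honour yet.  Negatives index (`ledger negatives`, 20 entries; the
Crystallization ones: GappedShellCensus.ShellCensus 15929, SpectralChargeLedger pricing 17253,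
BrittleMieDescent.EffectiveLocalHales 4146, OneGrainWindow.OneGrainGluing 3506): every `η`-SOFT local
classification / gluing statement there is avoided — stub 2 concludes EXACT environments from matching at
EVERY `η`, stub 3 is an `η = 0` rigidity statement, stub 1 is pure extraction.

BC3 probes (registrar folder `bc/`, 2026-08-17; all FAIL as required): per stub, `stub → ExactificationCascade`
and `stub → Crystallization` by `first | exact? | simpa | aesop` under `maxHeartbeats 400000` — rc 1 ×6
(stubs 1–2: deterministic whnf timeout inside the combinator; stub 3: `aesop: failed to prove the goal after
exhaustive search`, unsolved goal = the crux resp. `Crystallization`); and one tactic per example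
(`bc/probe2_*.lean`, 18 examples, rc 1 ×6 files): `exact?` "could not close the goal" 6/6, `simpa using hstub`
type mismatch 5/6 + whnf timeout 1/6, `aesop` exhaustive-search failure 2/6 + whnf timeout 4/6.  No stub is
cheaply the crux or the summit conjunct.
-/

noncomputable section

namespace Summit.AtomisticToContinuum.Crystallization.Cruxes.ExactificationCascade.Birth

open Filter Set Literature.MathematicalPhysics.StatisticalMechanics

/-! ## Registered stubs (sorries live ONLY here; one-line fully qualified signatures) -/

/-- **STUB 1 — CENTRED EXTRACTION OF A GOOD HULL ELEMENT** (size M; provable now; pure point-set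
compactness + counting, no potential): a uniformly `δ`-separated sequence of finite configurations `x N`
(`N` particles) in `ℝ³` whose `η`-defective particles — closed `(5a/3)`-neighbourhood NOT `η`-matched both
ways, up to a linear isometry, to the hcp(a,h) site environment (the crux's predicate verbatim) — have
density `→ 0` for EVERY `η > 0` admits a subsequence `σ`, translations `τ j` and a `δ`-separated set
`X ∋ 0` such that the recentred configurations `x (σ j) · + τ j` are two-way `ε`-matched with `X` on every
ball `‖·‖ ≤ R`, eventually in `j`, AND for every `R`, `η > 0`, eventually every recentred particle of norm
`≤ R` is `η`-good (stated for the recentred configuration; the predicate is translation invariant).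
Sketch: `τ N = −x N i_N` for a particle `i_N` with no `1/k`-defective particle within distance `k` for all
`k ≤ K(N) → ∞` (each defective particle spoils `≤ (2k/δ + 1)³` centres, so spoiled centres have density
`→ 0` at every fixed level); `exists_subseq_forall_eventually_ballMatch` (LocalMatchingCompactness.lean) on
the recentred point sets; `0 ∈ X` because `0` is a particle of every recentred configuration and `X` is
`δ`-separated.  Leans on: `hcpStacking` (BarlowStacking.lean), `exists_subseq_forall_eventually_ballMatch`,
`finite_of_forall_le_dist_of_subset_closedBall`; template: the landed `hullGoodEverywhere_proof`
(Theorems/HullExactificationCascadeHullGoodEverywhere*.lean, same extraction for the 13/10-shell predicate). -/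
theorem stub_centredExtraction : ∀ (a h δ : ℝ), 0 < δ → ∀ x : (N : ℕ) → (Fin N → EuclideanSpace ℝ (Fin 3)), (∀ (N : ℕ) (i j : Fin N), i ≠ j → δ ≤ dist (x N i) (x N j)) → (∀ η : ℝ, 0 < η → Filter.Tendsto (fun N : ℕ => (Nat.card {i : Fin N // ¬ (∃ A : EuclideanSpace ℝ (Fin 3) →ₗᵢ[ℝ] EuclideanSpace ℝ (Fin 3), (∀ p ∈ Literature.MathematicalPhysics.StatisticalMechanics.hcpStacking a h, ‖p‖ ≤ 5 / 3 * a → ∃ j : Fin N, dist (x N j) (x N i + A p) ≤ η) ∧ (∀ j : Fin N, dist (x N j) (x N i) ≤ 5 / 3 * a → ∃ p ∈ Literature.MathematicalPhysics.StatisticalMechanics.hcpStacking a h, dist (x N j) (x N i + A p) ≤ η))} : ℝ) / N) Filter.atTop (nhds 0)) → ∃ (σ : ℕ → ℕ) (τ : ℕ → EuclideanSpace ℝ (Fin 3)) (X : Set (EuclideanSpace ℝ (Fin 3))), StrictMono σ ∧ (0 : EuclideanSpace ℝ (Fin 3)) ∈ X ∧ (∀ p ∈ X, ∀ q ∈ X,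 p ≠ q → δ ≤ dist p q) ∧ (∀ R ε : ℝ, 0 < ε → ∀ᶠ j : ℕ in Filter.atTop, (∀ p ∈ X, ‖p‖ ≤ R → ∃ i : Fin (σ j), dist (x (σ j) i + τ j) p ≤ ε) ∧ (∀ i : Fin (σ j), ‖x (σ j) i + τ j‖ ≤ R → ∃ p ∈ X, dist (x (σ j) i + τ j) p ≤ ε)) ∧ (∀ R η : ℝ, 0 < η → ∀ᶠ j : ℕ in Filter.atTop, ∀ i : Fin (σ j), ‖x (σ j) i + τ j‖ ≤ R → ∃ A : EuclideanSpace ℝ (Fin 3) →ₗᵢ[ℝ] EuclideanSpace ℝ (Fin 3), (∀ p ∈ Literature.MathematicalPhysics.StatisticalMechanics.hcpStacking a h, ‖p‖ ≤ 5 / 3 * a → ∃ i' : Fin (σ j), dist (x (σ j) i' + τ j) (x (σ j) i + τ j + A p) ≤ η) ∧ (∀ i' : Fin (σ j), dist (x (σ j) i' + τ j) (x (σ j) i + τ j) ≤ 5 / 3 * a → ∃ p ∈ Literature.MathematicalPhysics.StatisticalMechanics.hcpStacking a h, dist (x (σ j) i' + τ j) (x (σ j) i + τ j + A p) ≤ η))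 := by
  sorry

/-- **STUB 2 — EXACTIFICATION IN THE LIMIT** (size M; provable now; the crux's first named risk): if
finite configurations `z j` (`n j` particles) are two-way `ε`-matched on every ball, eventually in `j`,
with a `δ`-separated `X ⊆ ℝ³`, and for every `R`, `η > 0` eventually every particle of norm `≤ R` is
`η`-good (closed `(5a/3)`-neighbourhood `η`-matched both ways to the hcp(a,h) environment after a linear
isometry), then EVERY `p ∈ X` has an EXACT environment: one linear isometry `A` with `p + A s ∈ X` for
every site `s ∈ hcpStacking a h`, `‖s‖ ≤ 5a/3`, and every `y ∈ X` with `dist y p < 5a/3` (OPEN ball: the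
boundary sphere is exactly where a closed clause does not pass to the limit) of the form `p + A s`.
Sketch: the 21 sites of norm `≤ 5a/3` (finite, `le_dist_of_mem_barlowStacking`) are sent, at a late time
with parameters `(ε, η)`, to points of the finite `X ∩ B̄(p, 5a/3 + 1)` within `2ε + η` of
`z i + A_j s`; one such map `F` recurs as `(ε, η) → 0`, so `F` is distance-exact with `F 0 = p`
(`X` separated); `s ↦ F s − p` preserves the Gram matrix and extends to a linear isometry `A` of `ℝ³`
(cf. the landed `ExactHcpLocal.exact_cluster`); a point `y ∈ X ∩ B°(p, 5a/3)` is approached by particles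
matched to `z i + A_j s_j` with `‖s_j‖ < 5a/3` eventually, whence `y = F s_j = p + A s_j`.
Leans on: `hcpStacking`, `le_dist_of_mem_barlowStacking`, `finite_of_forall_le_dist_of_subset_closedBall`,
Mathlib inner-product geometry (`LinearIsometry`, Gram/orthonormal extension). -/
theorem stub_exactEnvironments : ∀ (a h : ℝ), 0 < a → 0 < h → ∀ (n : ℕ → ℕ) (z : (j : ℕ) → (Fin (n j) → EuclideanSpace ℝ (Fin 3))) (X : Set (EuclideanSpace ℝ (Fin 3))) (δ : ℝ), 0 < δ → (∀ p ∈ X, ∀ q ∈ X, p ≠ q → δ ≤ dist p q) → (∀ R ε : ℝ, 0 < ε → ∀ᶠ j : ℕ in Filter.atTop, (∀ p ∈ X, ‖p‖ ≤ R → ∃ i : Fin (n j), dist (z j i) p ≤ ε) ∧ (∀ i : Fin (n j), ‖z j i‖ ≤ R → ∃ p ∈ X, dist (z j i) p ≤ ε)) → (∀ R η : ℝ, 0 < η → ∀ᶠ j : ℕ in Filter.atTop, ∀ i : Fin (n j), ‖z j i‖ ≤ R → ∃ A : EuclideanSpace ℝ (Fin 3) →ₗᵢ[ℝ] EuclideanSpace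 ℝ (Fin 3), (∀ p ∈ Literature.MathematicalPhysics.StatisticalMechanics.hcpStacking a h, ‖p‖ ≤ 5 / 3 * a → ∃ i' : Fin (n j), dist (z j i') (z j i + A p) ≤ η) ∧ (∀ i' : Fin (n j), dist (z j i') (z j i) ≤ 5 / 3 * a → ∃ p ∈ Literature.MathematicalPhysics.StatisticalMechanics.hcpStacking a h, dist (z j i') (z j i + A p) ≤ η)) → ∀ p ∈ X, ∃ A : EuclideanSpace ℝ (Fin 3) →ₗᵢ[ℝ] EuclideanSpace ℝ (Fin 3), (∀ s ∈ Literature.MathematicalPhysics.StatisticalMechanics.hcpStacking a h, ‖s‖ ≤ 5 / 3 * a → p + A s ∈ X) ∧ (∀ y ∈ X, dist y p < 5 / 3 * a → ∃ s ∈ Literature.MathematicalPhysics.StatisticalMechanics.hcpStacking a h, y = p + A s) := by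
  sorry

/-- **STUB 3 — RELAXED-hcp RIGIDITY FROM EXACT `5a/3`-ENVIRONMENTS** (size M–L; THE GEOMETRIC HEART; the
crux's second named risk): for `0 < a`, `0 < h` in the window `2a < 3h`, `6h < 5a` (i.e. `h/a ∈ (2/3, 5/6)`,
which contains the ideal ratio `√(2/3)` and the LJ-relaxed one), a NONEMPTY `X ⊆ ℝ³` every point `p` of
which has an exact hcp(a,h) environment — a linear isometry `A_p` with `p + A_p s ∈ X` for all sites
`‖s‖ ≤ 5a/3` (20 sites: hexagon at `a`, `3+3` at `√(a²/3+h²)`, `3+3` at `√(4a²/3+h²)`, axial pair at `2h`;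
the window keeps exactly these strictly inside `5a/3`) and `X ∩ B°(p, 5a/3) ⊆ p + A_p(hcp)` — is the image
of `hcpStacking a h` under a Euclidean isometry.  Sketch (crux docstring; landed template for the narrower
envelope `0.64a² < h² < 0.69a²` and the 13/10·a cluster: `ExactHcpLocal.all_layers`,
`eq_hcpStacking_of_clusters`, `eq_image_hcpStacking` in Theorems/HullExactificationCascadeExactHcpLocalTheorem*.lean):
normalise one point to `0` with `A = 1`; the hexagon pins the layer plane, the two `ρ₁`-triples pin the
adjacent layers over holes at spacing `h`, the axial pair forces ABAB; propagate along bonds (exactness on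
overlapping environments decides each new isometry — a finite check on sub-configurations, all `h/a` in the
window incl. the ideal one where the first twelve sites are equidistant); `hcp ⊆ X` by induction over
sites, and no foreign point: every `y ∈ ℝ³` is within the covering radius `< 5a/3` of a site
(`exists_hcp_site_near`), so the open-ball clause at that site places `y` in the stacking
(`hcpStacking_homogeneous` identifies site environments).  Why it might fail: exactly the crux's — a
non-periodic set all of whose `5a/3`-environments are hcp(a,h)-isometric (none expected; refuter growth
checks `grow_rigidity.py` / `ideal_rigidity.py` on the crux found 0 ambiguous extensions at 5 ratios).
Leans on: `hcpStacking`, `barlowPos`, `hcpStacking_homogeneous` (HcpHomogeneous.lean), `exists_hcp_site_near`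
(HcpSiteGeometry.lean), `halfTurn`, Mathlib `IsometryEquiv` / `LinearIsometryEquiv`. -/
theorem stub_relaxedHcpRigidity : ∀ (a h : ℝ), 0 < a → 0 < h → 2 * a < 3 * h → 6 * h < 5 * a → ∀ X : Set (EuclideanSpace ℝ (Fin 3)), X.Nonempty → (∀ p ∈ X, ∃ A : EuclideanSpace ℝ (Fin 3) →ₗᵢ[ℝ] EuclideanSpace ℝ (Fin 3), (∀ s ∈ Literature.MathematicalPhysics.StatisticalMechanics.hcpStacking a h, ‖s‖ ≤ 5 / 3 * a → p + A s ∈ X) ∧ (∀ y ∈ X, dist y p < 5 / 3 * a → ∃ s ∈ Literature.MathematicalPhysics.StatisticalMechanics.hcpStacking a h, y = p + A s)) → ∃ g : EuclideanSpace ℝ (Fin 3) ≃ᵢ EuclideanSpace ℝ (Fin 3), X = g '' Literature.MathematicalPhysics.StatisticalMechanics.hcpStacking a h := by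
  sorry

/-! ## The kernel-checked composition (no `sorry` of its own) -/

/-- THE REAL PROOF (sorry-free): `stub_centredExtraction-sig → stub_exactEnvironments-sig →
stub_relaxedHcpRigidity-sig → <the crux statement>`; the conclusion is the text of the route decl
`OneCentreSteepnessLadder.ExactificationCascade` VERBATIM (definitionally equal; spelled out, not named, so
that exactly ONE theorem of this file — `ExactificationCascade_of` below — concludes the crux BY NAME).
Content beyond plumbing: the PERIODIC REALISATION — `g '' hcpStacking a h` is the point set of a periodic
configuration (Mazur–Ulam via the landed `hullPeriodic_exists_points_eq_image`, `hcpPeriodicConfiguration_points`),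
multiplicity `m ≡ 1`, and Blanc–Lewin's local convergence (16) from two-way matching + the crux's
separation `δ` (`PeriodicConfiguration.tendsto_sum_of_eventually_near'`). -/
theorem ExactificationCascade_of_parts : (∀ (a h δ : ℝ), 0 < δ → ∀ x : (N : ℕ) → (Fin N → EuclideanSpace ℝ (Fin 3)), (∀ (N : ℕ) (i j : Fin N), i ≠ j → δ ≤ dist (x N i) (x N j)) → (∀ η : ℝ, 0 < η → Filter.Tendsto (fun N : ℕ => (Nat.card {i : Fin N // ¬ (∃ A : EuclideanSpace ℝ (Fin 3) →ₗᵢ[ℝ] EuclideanSpace ℝ (Fin 3), (∀ p ∈ Literature.MathematicalPhysics.StatisticalMechanics.hcpStacking a h, ‖p‖ ≤ 5 / 3 * a → ∃ j : Fin N, dist (x N j) (x N i + A p) ≤ η) ∧ (∀ j : Fin N, dist (x N j) (x N i) ≤ 5 / 3 * a → ∃ p ∈ Literature.MathematicalPhysics.StatisticalMechanics.hcpStacking a h, dist (x N j) (x N i + A p) ≤ η))} : ℝ) / N) Filter.atTop (nhds 0)) → ∃ (σ : ℕ → ℕ) (τ : ℕ → EuclideanSpace ℝ (Fin 3)) (X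 : Set (EuclideanSpace ℝ (Fin 3))), StrictMono σ ∧ (0 : EuclideanSpace ℝ (Fin 3)) ∈ X ∧ (∀ p ∈ X, ∀ q ∈ X, p ≠ q → δ ≤ dist p q) ∧ (∀ R ε : ℝ, 0 < ε → ∀ᶠ j : ℕ in Filter.atTop, (∀ p ∈ X, ‖p‖ ≤ R → ∃ i : Fin (σ j), dist (x (σ j) i + τ j) p ≤ ε) ∧ (∀ i : Fin (σ j), ‖x (σ j) i + τ j‖ ≤ R → ∃ p ∈ X, dist (x (σ j) i + τ j) p ≤ ε)) ∧ (∀ R η : ℝ, 0 < η → ∀ᶠ j : ℕ in Filter.atTop, ∀ i : Fin (σ j), ‖x (σ j) i + τ j‖ ≤ R → ∃ A : EuclideanSpace ℝ (Fin 3) →ₗᵢ[ℝ] EuclideanSpace ℝ (Fin 3), (∀ p ∈ Literature.MathematicalPhysics.StatisticalMechanics.hcpStacking a h, ‖p‖ ≤ 5 / 3 * a → ∃ i' : Fin (σ j), dist (x (σ j) i' + τ j) (x (σ j) i + τ j + A p) ≤ η) ∧ (∀ i' : Fin (σ j), dist (x (σ j) i' + τ j) (x (σ j) i + τ j) ≤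 5 / 3 * a → ∃ p ∈ Literature.MathematicalPhysics.StatisticalMechanics.hcpStacking a h, dist (x (σ j) i' + τ j) (x (σ j) i + τ j + A p) ≤ η))) → (∀ (a h : ℝ), 0 < a → 0 < h → ∀ (n : ℕ → ℕ) (z : (j : ℕ) → (Fin (n j) → EuclideanSpace ℝ (Fin 3))) (X : Set (EuclideanSpace ℝ (Fin 3))) (δ : ℝ), 0 < δ → (∀ p ∈ X, ∀ q ∈ X, p ≠ q → δ ≤ dist p q) → (∀ R ε : ℝ, 0 < ε → ∀ᶠ j : ℕ in Filter.atTop, (∀ p ∈ X, ‖p‖ ≤ R → ∃ i : Fin (n j), dist (z j i) p ≤ ε) ∧ (∀ i : Fin (n j), ‖z j i‖ ≤ R → ∃ p ∈ X, dist (z j i) p ≤ ε)) → (∀ R η : ℝ, 0 < η → ∀ᶠ j : ℕ in Filter.atTop, ∀ i : Fin (n j), ‖z j i‖ ≤ R → ∃ A : EuclideanSpace ℝ (Fin 3) →ₗᵢ[ℝ] EuclideanSpace ℝ (Fin 3), (∀ p ∈ Literature.MathematicalPhysics.StatisticalMechanics.hcpStacking a h, ‖p‖ ≤ 5 / 3 *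 a → ∃ i' : Fin (n j), dist (z j i') (z j i + A p) ≤ η) ∧ (∀ i' : Fin (n j), dist (z j i') (z j i) ≤ 5 / 3 * a → ∃ p ∈ Literature.MathematicalPhysics.StatisticalMechanics.hcpStacking a h, dist (z j i') (z j i + A p) ≤ η)) → ∀ p ∈ X, ∃ A : EuclideanSpace ℝ (Fin 3) →ₗᵢ[ℝ] EuclideanSpace ℝ (Fin 3), (∀ s ∈ Literature.MathematicalPhysics.StatisticalMechanics.hcpStacking a h, ‖s‖ ≤ 5 / 3 * a → p + A s ∈ X) ∧ (∀ y ∈ X, dist y p < 5 / 3 * a → ∃ s ∈ Literature.MathematicalPhysics.StatisticalMechanics.hcpStacking a h, y = p + A s)) → (∀ (a h : ℝ), 0 < a → 0 < h → 2 * a < 3 * h → 6 * h < 5 * a → ∀ X : Set (EuclideanSpace ℝ (Fin 3)), X.Nonempty → (∀ p ∈ X, ∃ A : EuclideanSpace ℝ (Fin 3) →ₗᵢ[ℝ] EuclideanSpace ℝ (Fin 3), (∀ s ∈ Literature.MathematicalPhysics.StatisticalMechanics.hcpStacking a h, ‖s‖ ≤ 5 / 3 * a → p + A s ∈ X) ∧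 (∀ y ∈ X, dist y p < 5 / 3 * a → ∃ s ∈ Literature.MathematicalPhysics.StatisticalMechanics.hcpStacking a h, y = p + A s)) → ∃ g : EuclideanSpace ℝ (Fin 3) ≃ᵢ EuclideanSpace ℝ (Fin 3), X = g '' Literature.MathematicalPhysics.StatisticalMechanics.hcpStacking a h) → (∀ q : ℕ, 4 ≤ q → ∀ δ a h : ℝ, 0 < δ → 0 < a → 0 < h → 2 * a < 3 * h → 6 * h < 5 * a → (∀ (N : ℕ) (x : Fin N → EuclideanSpace ℝ (Fin 3)), Literature.MathematicalPhysics.StatisticalMechanics.IsGroundState (Literature.MathematicalPhysics.StatisticalMechanics.miePotential q) x → ∀ i j : Fin N, i ≠ j → δ ≤ dist (x i) (x j)) → (∀ η : ℝ, 0 < η → ∀ x : (N : ℕ) → (Fin N → EuclideanSpace ℝ (Fin 3)), (∀ N, Literature.MathematicalPhysics.StatisticalMechanics.IsGroundState (Literature.MathematicalPhysics.StatisticalMechanics.miePotential q) (x N)) → Filter.Tendsto (fun N : ℕ => (Nat.card {i : Fin N // ¬ (∃ A : EuclideanSpace ℝ (Fin 3) →ₗᵢ[ℝ] EuclideanSpace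 ℝ (Fin 3), (∀ p ∈ Literature.MathematicalPhysics.StatisticalMechanics.hcpStacking a h, ‖p‖ ≤ 5 / 3 * a → ∃ j : Fin N, dist (x N j) (x N i + A p) ≤ η) ∧ (∀ j : Fin N, dist (x N j) (x N i) ≤ 5 / 3 * a → ∃ p ∈ Literature.MathematicalPhysics.StatisticalMechanics.hcpStacking a h, dist (x N j) (x N i + A p) ≤ η))} : ℝ) / N) Filter.atTop (nhds 0)) → Literature.MathematicalPhysics.StatisticalMechanics.IsCrystallizing (Literature.MathematicalPhysics.StatisticalMechanics.miePotential q) 3) := by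
  intro h1 h2 h3 q _hq δ a h hδ ha hh hw₁ hw₂ hsep hdef x hx
  -- (0) separation and zero defect density of THIS ground-state sequence, from the crux hypotheses
  have hxsep : ∀ (N : ℕ) (i j : Fin N), i ≠ j → δ ≤ dist (x N i) (x N j) :=
    fun N i j hij => hsep N (x N) (hx N) i j hij
  -- (1) centred extraction: subsequence, recentrings, separated local limit `X ∋ 0`, eventual goodness
  obtain ⟨σ, τ, X, hσ, h0X, hXsep, hmatch, hgood⟩ := h1 a h δ hδ x hxsep (fun η hη => hdef η hη x hx)
  -- (2) exactification in the limit: every point of `X` has an exact hcp(a,h) environment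
  have hexact := h2 a h ha hh σ (fun j i => x (σ j) i + τ j) X δ hδ hXsep hmatch hgood
  -- (3) relaxed-hcp rigidity: `X` is an isometric image of the stacking
  obtain ⟨g, hXg⟩ := h3 a h ha hh hw₁ hw₂ X ⟨0, h0X⟩ hexact
  -- (4) periodic realisation: `g '' hcp` is the point set of a periodic configuration (Mazur–Ulam)
  obtain ⟨P', hP'⟩ :=
    Summit.AtomisticToContinuum.Crystallization.Theorems.hullPeriodic_exists_points_eq_image
      (hcpPeriodicConfiguration ha.ne' hh.ne') g
  rw [hcpPeriodicConfiguration_points] at hP'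
  refine ⟨σ, τ, P', fun _ => 1, hσ, fun _ _ => le_rfl, fun _ _ _ => rfl, ?_⟩
  intro f hfc hf
  -- (5) Blanc–Lewin (16) from two-way matching of `δ`-separated configurations, multiplicity one
  have hsep' : ∀ (j : ℕ) (i i' : Fin (σ j)), i ≠ i' →
      δ ≤ dist (x (σ j) i + τ j) (x (σ j) i' + τ j) := by
    intro j i i' hii'
    rw [dist_add_right]
    exact hxsep (σ j) i i' hii'
  have h' : ∀ R ε : ℝ, 0 < ε → ∀ᶠ j in atTop,
      (∀ s ∈ P'.points, ‖s‖ ≤ R → ∃ i : Fin (σ j), dist (x (σ j) i + τ j) s ≤ ε) ∧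
      (∀ i : Fin (σ j), ‖x (σ j) i + τ j‖ ≤ R → ∃ s ∈ P'.points, dist (x (σ j) i + τ j) s ≤ ε) := by
    intro R ε hε
    rw [hP', ← hXg]
    exact hmatch R ε hε
  exact P'.tendsto_sum_of_eventually_near' (fun j (i : Fin (σ j)) => x (σ j) i + τ j) hδ hsep' h' hfc hf

/-- THE SKELETON THEOREM: the three registered stubs compose to the crux, concluded BY NAME (the route decl
`Summit.AtomisticToContinuum.Crystallization.Theses.OneCentreSteepnessLadder.ExactificationCascade`); its
only `sorry`s are the stubs'.  When the stubs land (`propose --supports stmt-AtomisticToContinuum-12885`,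
by name + signature), this file minus the `sorry`s is the crux proof (`propose --workitem`). -/
theorem ExactificationCascade_of : Summit.AtomisticToContinuum.Crystallization.Theses.OneCentreSteepnessLadder.ExactificationCascade :=
  ExactificationCascade_of_parts stub_centredExtraction stub_exactEnvironments stub_relaxedHcpRigidity

end Summit.AtomisticToContinuum.Crystallization.Cruxes.ExactificationCascade.Birth

end
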